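import Summits.ResolutionOfSingularities.ResolutionOfSingularities.Theorems.FrobeniusClosingPatchingRelPerfectDepthFlagTargets
import HarnessLib

/-!
# Chain W5.2 — TargetsF6 v1.1 (plan-1 g8, sha16 7001d3757fbb0aa3), module 2 of 3: §4–§6 — STAGE 2 («separation of two regular
# hypersurfaces»: weight-one sequences with boundary keyed on `𝔟`, the stage-2 X-side format targets) and the ENGINES (definitions)

rev 2 (filer, res-D-pv-059 AS res-L1-w52-lead-2): + `SeparationBoundaryNil₃` = plan-1's TargetsF6 **v1.2** statement of T6-E2 (RULING R2a
2026-08-27T10:19:07Z: the separation target is stated at the junction input `𝒟 = []`); the v1.1 decl `SeparationBoundary₃` (`∀ 𝒟` form) above it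
is a SUPERSEDED RECORD (filed 10:28Z before the filer read the 10:19Z HOLD; Theorems files are append-only) — NOT a target, never staffed;
the compositions (module 3 `…DepthFlagSepCompositions`) consume `SeparationBoundaryNil₃` only.

[OURS · L1 W5.2] Statements (Props); NOT statements of the manuscript under review; AI-typed, weaker than expert review.
Crux `PatchingRelPerfect` (stmt-ResolutionOfSingularities-16161), line `closed_point_slice`, open stub `stub_atomDimFourBlowup` (CORE).
See module 1 `…DepthFlagTargets` for the full header of TargetsF6 (architecture, dictionary, holders, references); this module is the
verbatim continuation (§4 = part S v0 078cf7ab definitions unchanged; §5 X-side generic in a stage-2 format `Q i K N 𝒟`; §6 the engines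
`SepEngine Q`, `FlagEngineTwo Q₁`).  PROVED compositions: module 3 `…DepthFlagSepCompositions`.  Fact-free except F-32bR inside
`SeparationBoundary₃`; F-33 occurs nowhere.

## References (pointers in prose; bib keys of `docs/references.bib`)
* E. Bierstone, D. Grigoriev, P. Milman, J. Włodarczyk, *Effective Hironaka resolution and its complexity*, Asian J. Math. 15 (2011),
  Def. 3.1.3, §3.2 Lemma 3.2.1, §4. [BierstoneGrigorievMilmanWlodarczyk2011]
* V. Cossart, U. Jannsen, S. Saito, *Desingularization: invariants and strategy*, LNM 2270 (2020), Thm. 1.4, Def. 4.1. [CossartJannsenSaito2020]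
* J. Kollár, *Lectures on Resolution of Singularities* (2007), (3.111) Step 3; 3.30.2. [Kollar2007]
* H. Hironaka, *Three key theorems on infinitely near singularities*, Sémin. Congr. 10 (2005), Lemma 10.3. [Hironaka2005]
* The Stacks Project, Tags 080A, 080B. [StacksProject]
-/

set_option linter.dupNamespace false

noncomputable section

open CategoryTheory CategoryTheory.Limits AlgebraicGeometry TopologicalSpace
open Literature.AlgebraicGeometry.Resolution
open Scheme.IdealSheafData

namespace Summit.ResolutionOfSingularities.ResolutionOfSingularities.Theorems.DepthTargets

universe u

/-! ## §4 STAGE 2, E-side: weight-one sequences with boundary, keyed on `𝔟` (= part S v0 078cf7ab, definitions unchanged) -/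

/-- [OURS · L1 W5.2] **`OrdLeOneAt 𝔟 z`: the order of `𝔟` at `z` is at most one** (`𝔟_z ⊄ 𝔪_z²`), the guard of the JOINT clause
and the first clause of the END of stage 2. [cite: BierstoneGrigorievMilmanWlodarczyk2011, §3.1 p. 6] -/
def OrdLeOneAt {E : Scheme.{u}} (𝔟 : E.IdealSheafData) (z : E) : Prop :=
  ¬ stalkIdeal 𝔟 z ≤ IsLocalRing.maximalIdeal (E.presheaf.stalk z) ^ 2

/-- [OURS · L1 W5.2] **`CoincidesAt 𝔟 𝒟 z`: at `z`, `𝔟` is locally the trace of a boundary member** (a member of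
`boundaryOf 𝒟` through `z` with the same stalk ideal as `𝔟`) — the case in which the X-side reads the snc of the pockets over `z`
off the boundary alone. [folklore] -/
def CoincidesAt {E : Scheme.{u}} (𝔟 : E.IdealSheafData) (𝒟 : List (E.IdealSheafData × ℕ)) (z : E) : Prop :=
  ∃ B ∈ boundaryOf 𝒟, z ∈ B.support ∧ stalkIdeal B z = stalkIdeal 𝔟 z

/-- [OURS · L1 W5.2] **The N-charged members** of an exponent list (exponent `> 0`), as a list of ideal sheaves. [folklore] -/
def chargedOf {E : Scheme.{u}} (𝒟 : List (E.IdealSheafData × ℕ)) : List E.IdealSheafData :=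
  (𝒟.filter fun p => 0 < p.2).map Prod.fst

/-- [OURS · L1 W5.2] **The JOINT clause of stage 2 at a centre point `z`** (owed only where `ord_z 𝔟 ≤ 1`): either `𝔟`
coincides at `z` with a boundary trace, or `𝔟 :: (N-charged traces)` is simple normal crossings jointly WITH the centre at `z`.
(`𝔟 ≤ C` is a separate, global clause of the step.) [cite: CossartJannsenSaito2020, Def. 3.1, Def. 4.1] -/
def SepJointAt {E : Scheme.{u}} (𝔟 C : E.IdealSheafData) (𝒟 : List (E.IdealSheafData × ℕ)) (z : E) : Prop :=
  CoincidesAt 𝔟 𝒟 z ∨ DepthSNC.SNCWithAt (𝔟 :: chargedOf 𝒟) C z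

/-- [OURS · L1 W5.2] **`IsSepSeq ρ 𝔟 𝒟 𝔟' 𝒟'` — WEIGHT-ONE sequences with boundary, keyed on `𝔟`** (stage 2 of F6):
`ρ : E' ⟶ E` is a composite of blowings up in CONNECTED regular centres `C ⊆ V(𝔟')` having snc and uniform incidence with the
boundary, with the order-guarded JOINT clause at the centre points of order `≤ 1`; the state is `(𝔟', 𝒟')` = (controlled
transform of weight one, strict transforms of the members with their N-exponents ++ [exceptional divisor with N-exponent
`w_𝒟(C) + 1`]).  Surface centres (a boundary trace inside `V(𝔟')`: PEEL) are allowed; no carried host, no host exponents, no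
max-weight clause. [cite: CossartJannsenSaito2020, Thm. 1.4, Def. 4.1] [cite: BierstoneGrigorievMilmanWlodarczyk2011, Def. 3.1.3] -/
inductive IsSepSeq :
    ∀ {E' E : Scheme.{u}}, (E' ⟶ E) → E.IdealSheafData → List (E.IdealSheafData × ℕ) →
      E'.IdealSheafData → List (E'.IdealSheafData × ℕ) → Prop
  /-- the empty sequence -/
  | nil {E : Scheme.{u}} (𝔟 : E.IdealSheafData) (𝒟 : List (E.IdealSheafData × ℕ)) : IsSepSeq (𝟙 E) 𝔟 𝒟 𝔟 𝒟
  /-- one more blowing up of weight one along a connected regular centre inside `V(𝔟')`, snc and uniformly incident with the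
  boundary, with the order-guarded JOINT clause -/
  | cons {E'' E' E : Scheme.{u}} (τ : E'' ⟶ E') (ρ : E' ⟶ E) (𝔟 : E.IdealSheafData) (𝒟 : List (E.IdealSheafData × ℕ))
      (𝔟' : E'.IdealSheafData) (𝒟' : List (E'.IdealSheafData × ℕ)) (C : E'.IdealSheafData) :
      IsSepSeq ρ 𝔟 𝒟 𝔟' 𝒟' →
      Scheme.IsRegular C.subscheme → _root_.IsPreconnected (C.support : Set E') →
      𝔟' ≤ C →
      HasSNCWith (boundaryOf 𝒟') C → UniformPieces 𝒟' C [C.support] →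
      (∀ z : E', z ∈ C.support → OrdLeOneAt 𝔟' z → SepJointAt 𝔟' C 𝒟' z) →
      IsBlowup τ C →
      IsSepSeq (τ ≫ ρ) 𝔟 𝒟 (controlledTransform τ C 𝔟' 1)
        (𝒟'.map (fun p => (strictTransformIdeal τ C p.1, p.2)) ++
          [(C.comap τ, weightOf 𝒟' (divisorsOver 𝒟' C C.support) + 1)])

/-- [OURS · L1 W5.2] **The END of stage 2, `EndSep 𝔟 𝒟`**: at every point of `V(𝔟)` the order of `𝔟` is at most one
(the components of `H ∩ E` are reduced and pairwise disjoint), no N-charged member coincides with `𝔟` there, and the JOINT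
condition holds with the empty centre (`⊤`).  This is exactly what the X-side needs to present `K = 𝓗 ⊔ N·𝓘_E²` as a sum of two
monomials in the pointwise-snc family `{𝓗, 𝓘_E, charged G}` along `cosupp K` (`EndTwoMonomialSep`).
[cite: Kollar2007, (3.111) Step 3] -/
def EndSep {E : Scheme.{u}} (𝔟 : E.IdealSheafData) (𝒟 : List (E.IdealSheafData × ℕ)) : Prop :=
  ∀ x : E, x ∈ 𝔟.support →
    OrdLeOneAt 𝔟 x ∧
    (∀ q ∈ 𝒟, 0 < q.2 → x ∈ q.1.support → stalkIdeal q.1 x ≠ stalkIdeal 𝔟 x) ∧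
    SepJointAt 𝔟 ⊤ 𝒟 x

/-- [OURS · L1 W5.2] **TARGET T6-E2 «SEPARATION WITH BOUNDARY» `SeparationBoundary₃`** (E-side driver of stage 2; L,
multi-session; F-32bR inside the statement as in T5-E): on an integral Noetherian regular excellent threefold `E` with an snc
boundary all of whose N-exponents are zero, every non-zero locally principal `𝔟` is carried by an `IsSepSeq` to an `EndSep` state
on an integral Noetherian regular `E'`.  Intended route (memo §2, sharpened): (1) CJS WITH BOUNDARY (F-32bR^B) for the
reduced NON-boundary part `D` of `V(𝔟)` (boundary = all traces), every centre split into its connected components (P2): centres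
of the first kind lie in `Sing D` (order `≥ 2`: JOINT not owed), centres of the second kind (separating `D` from old traces) pass
through order-one points, where the JOINT family is `𝔟' :: (CJS-born traces through z)`, each born transversal to `D` at an
order-one centre and kept snc by snc-centred blowings up — the prover's invariant; at the end `D` is regular (components
disjoint) and snc with every trace; (2) PEEL every surface `S` with `𝔟 ≤ 𝓘_S` of multiplicity `≥ 2`, or of multiplicity `1`
meeting another component (`C = S`, `τ` an iso, multiplicity `− 1`, new entry `(S, a + 1)`, old entry `↦ (⊤, a)`; JOINT by the
coincidence disjunct or not owed) until `ord 𝔟 ≤ 1` on `V(𝔟)`; NO blowing up of intersection curves is needed (an order-one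
crossing of `D` with an N-charged trace is allowed by `EndSep`).  Terminates by total multiplicity.  Why it might fail: the
transversality invariant of (1) at a second-kind centre meeting a CJS-born trace where CJS's own bookkeeping does not keep `D`
transversal (then carry it as an extra clause of the driver's invariant, as res-D-pv-054 does in T5-E), or F-32bR^B's centres not
being connected / uniformly incident before splitting (P2, p510611).  The driver's INVARIANT (transversality of `D` to the
CJS-born traces; JOINT read off permissibility) is to be STATED in the closer's module (tri-2 TRIAGE v9 s1–s5).  Input here is
always the junction state `𝒟 = []` (all stage-1 exceptional surfaces uncharged), but the Prop is kept general.  Holder: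
res-L1-w52-stub-1 g4 (TAKING 09:49:12Z): Phase B «PEEL-ALL» first (each peel a legal `IsSepSeq.cons` with `τ` an isomorphism),
then Phase A = CJS with `B = ∅` on `V(𝔟)_red`, ISO-tolerant as `WeightTwoB.cjs_transport`, invariant «every stage-2 trace `≠ ⊤` is a
component of `V(𝔟')`» under which JOINT is never owed in Phase A.
(cf. Cossart–Jannsen–Saito 2020 = bib CossartJannsenSaito2020, Thm. 1.4, Def. 4.1 — OURS node; pointer in prose, the Prop
being parameterless) -/
def SeparationBoundary₃ : Prop :=
  CossartJannsenSaito2020EmbeddedSequenceB.{u} →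
  ∀ (E : Scheme.{u}) [IsIntegral E] [IsNoetherian E], Scheme.IsRegular E → Scheme.IsExcellent E →
    topologicalKrullDim E = 3 →
    ∀ (𝔟 : E.IdealSheafData) (𝒟 : List (E.IdealSheafData × ℕ)), 𝔟 ≠ ⊥ → IsLocallyPrincipal 𝔟 →
      HasSNC (boundaryOf 𝒟) → (∀ q ∈ 𝒟, q.2 = 0) →
      ∃ (E' : Scheme.{u}) (ρ : E' ⟶ E) (𝔟' : E'.IdealSheafData) (𝒟' : List (E'.IdealSheafData × ℕ)),
        IsSepSeq ρ 𝔟 𝒟 𝔟' 𝒟' ∧ IsIntegral E' ∧ IsNoetherian E' ∧ Scheme.IsRegular E' ∧ EndSep 𝔟' 𝒟'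

/-- [OURS · L1 W5.2] **TARGET T6-E2 «SEPARATION FROM THE EMPTY BOUNDARY» `SeparationBoundaryNil₃`** (E-side driver of stage 2; the TARGET OF RECORD — the preceding `SeparationBoundary₃` (TargetsF6 v1.1, the `∀ 𝒟` form) reached the tree 2 min after RULING R2a and is a SUPERSEDED RECORD, never staffed, append-only;
L, multi-session; F-32bR inside the statement as in T5-E; **v1.2: stated at the junction input `𝒟 = []`**, RULING R2a): on an
integral Noetherian regular excellent threefold `E`, every non-zero locally principal `𝔟` is carried by an `IsSepSeq` FROM THE
EMPTY BOUNDARY to an `EndSep` state on an integral Noetherian regular `E'`.  This is exactly what `flagEngineTwo_threefold` feeds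
(the junction `InitialSep` establishes `N = ⊤`, `𝒟 = []`; stage-1 exceptional surfaces are never N-charged and their traces are
ordinary components of `V(𝔟)`).  WHY NOT `∀ 𝒟` (v1.1): with uncharged snc old members the cons clauses `HasSNCWith (boundaryOf 𝒟') C`
/ `UniformPieces 𝒟' C` bind every centre to the ORIGINAL traces, which the `B = ∅` fact F-32bR never sees — witness (res-L1-w52-stub-1
/ res-D-pv-054, independently): `E ⊇ B = V(x − z²)` regular uncharged, `𝔟 = (x² − y³)`, `Sing V(𝔟) = V(x, y)` TANGENT to `B` at the
origin, so the CJS step «blow up `V(x, y)`» is not an `IsSepSeq` step; the `∀ 𝒟` form is plausibly true but would need CJS WITH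
initial boundary (F-32bR^B / F-60), a second fact this engine does not admit.  `IsSepSeq` / `EndSep` / the X-side targets stay
GENERAL in `𝒟`.  Intended route (holders' cut 10:15–10:18Z): PHASE A (res-D-pv-054 g6, GO 10:19:07Z) = CJS with `B = ∅` on `V(𝔟)_red`
transported ISO-tolerantly into `IsSepSeq ρ 𝔟 [] (𝔡' * monomialIdeal ℬ') 𝒟_A` as the weight-ONE analogue of
`WeightTwoB.cjs_transport` (P2 splitting p510611, P3 p509976, (L-A) p512756/p513423, (L-G) p517627): carried invariant «`V(𝔟_j) =
X_j ∪` (born traces), every born trace CHARGED and a component of `V(𝔟_j)`», under which JOINT is NEVER owed (every centre point has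
`ord_z 𝔟_j ≥ 2`: `hBsing` or `z` on a born trace and on `X_j`) and NO per-component multiplicity is carried (the transport
`τᶜ(𝔟_j, 1)` needs only `𝔟_j ≤ 𝓘_Z`); A-END = CJS end (`X_A` regular, `B_A` snc, `X_A ⋔ B_A`) ⇒ MID state `𝔟_A = monomialIdeal 𝒮`
(re-derived from «locally principal + `V(𝔟_A)` inside an snc family», UFD stalks).  PHASE B (res-L1-w52-stub-1 g4, holder; brick 1
p521900 `…DepthSepPeelStep`) = PEEL every member of `𝒮` (`C = S`, `τ` an iso, `IsSepSeq.cons` legal: JOINT by the coincidence disjunct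
or not owed) down to `𝔟' = ⊤`, where `EndSep ⊤ 𝒟'` is vacuous; MID interface = stub-1's accumulator `peelAll`; composition
`separationBoundary₃_holds` = stub-1.  Terminates by total multiplicity.  Why it might fail: F-32bR's centres not connected /
uniformly incident before splitting (P2), or the born-trace invariant breaking at a CJS centre meeting two born traces
non-transversally to `X_j` (CJS's own `B`-permissibility is the guard; carry it as a clause of the invariant as in T5-E).
(cf. Cossart–Jannsen–Saito 2020 = bib CossartJannsenSaito2020, Thm. 1.4, Def. 4.1 — OURS node; pointer in prose, the Prop
being parameterless) -/
def SeparationBoundaryNil₃ : Prop :=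
  CossartJannsenSaito2020EmbeddedSequenceB.{u} →
  ∀ (E : Scheme.{u}) [IsIntegral E] [IsNoetherian E], Scheme.IsRegular E → Scheme.IsExcellent E →
    topologicalKrullDim E = 3 →
    ∀ (𝔟 : E.IdealSheafData), 𝔟 ≠ ⊥ → IsLocallyPrincipal 𝔟 →
      ∃ (E' : Scheme.{u}) (ρ : E' ⟶ E) (𝔟' : E'.IdealSheafData) (𝒟' : List (E'.IdealSheafData × ℕ)),
        IsSepSeq ρ 𝔟 ([] : List (E.IdealSheafData × ℕ)) 𝔟' 𝒟' ∧
          IsIntegral E' ∧ IsNoetherian E' ∧ Scheme.IsRegular E' ∧ EndSep 𝔟' 𝒟'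

/-! ## §5 STAGE 2, X-side: generic in a stage-2 format `Q i K N 𝒟` -/

/-- [OURS · L1 W5.2] **`StepSepOne Q` — the formatted WEIGHT-ONE step of stage 2**: at a state of the monomial-contact invariant
of depth two in format `Q` (owner res-D-pv-016 AS stub-5; intended instance `DepthGraded.SepFormat i K N 𝒟`: `K = 𝓗 ⊔ N·𝓘_E²`
with `𝓗` an effective Cartier divisor REGULAR at the points of `i(E) ∩ cosupp K` (a generator outside `𝔪²`), `𝓗|_E = K|_E`,
`N = monomialIdeal 𝒩` with `𝒩|_E = 𝒟`, global `HasSNC (𝓘_E :: boundaryOf 𝒩)`, the transversality «`𝓗 ⋔ G` at coincidence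
points of N-charged `G`», and the POCKET FIELD `∀ x ∈ supp K ∖ i(E), SNCWithAt (𝓗 :: i.ker :: boundaryOf (charged 𝒩)) ⊤ x` as
LANDED (p520204; the `i.ker` member is vacuous off `i(E)` — res-D-pv-009 q5′ (P1): what must NOT happen is feeding a family with both
`i.ker` and `𝓗` to `pocketSNC_step` AT a PEEL centre point, where it is never snc with `Ĉ = (g, e)`)),
every `IsSepSeq.cons` datum on the E-side is matched by the
blowing up `σ` of `X` along `i(C)` with weight one, the invariant re-established with `N' = N𝒪 · 𝓘_exc`, restriction commuting
with the controlled transform, and `Q` again at the transported state.  Tools: `HostMonoFormat.step` (no codimension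
hypothesis: PEEL centres included), `IsBlowup.retractLift`, the pieces calculus with the single piece `V(C)`,
`BoundaryRel.transform`; host transport (β, RECOMMENDED): `strictTransformIdeal σ Ĉ 𝓗 = σᶜ(𝓗, 1)` globally by res-D-pv-026's
`IsBlowup.strictTransformIdeal_eq_controlledTransform` (p513423, `m = 1`: order one at the generic point of the connected centre
because a generator lies outside `𝔪²` at its closed points), then plain `pocketSNC_step` (p512884) on the family `𝓗 :: charged 𝒢`;
regularity of the transported host along `i'(E')` = res-D-pv-021's `…DepthHostRegularTransport` assembly
(`SNCWithAt.singleton_of_span_singleton`, `cons_of_stalkIdeal_le`, `IsBlowup.sncWithAt_transform_of_mem_support`); feeders of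
`hpocket` at a centre point: JOINT case `DepthRetract.sncWithAt_host_cons` + `.anti`, coincidence case
`DepthSNC.SNCWithAt.coincidence_swap`, tangency case `SNCWithAt.tangent_swap` (res-D-pv-009 p519194).
[cite: BierstoneGrigorievMilmanWlodarczyk2011, §3.2 Lemma 3.2.1, §4 Step 2a] -/
def StepSepOne
    (Q : ∀ ⦃E X : Scheme.{u}⦄, (E ⟶ X) → X.IdealSheafData → X.IdealSheafData → List (E.IdealSheafData × ℕ) → Prop) :
    Prop :=
  ∀ (S : Type u) [CommRing S] [IsRegularLocalRing S] (I : Ideal S)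
    (E X : Scheme.{u}) (i : E ⟶ X) (g : X ⟶ Spec (.of S)) (K N : X.IdealSheafData) (𝒟 : List (E.IdealSheafData × ℕ)),
    DepthInvariantMono 2 S I E X i g K N → Q i K N 𝒟 →
    ∀ (E' : Scheme.{u}) (τ : E' ⟶ E) (C : E.IdealSheafData),
      Scheme.IsRegular C.subscheme → _root_.IsPreconnected (C.support : Set E) → K.comap i ≤ C →
      HasSNCWith (boundaryOf 𝒟) C → UniformPieces 𝒟 C [C.support] →
      (∀ z : E, z ∈ C.support → OrdLeOneAt (K.comap i) z → SepJointAt (K.comap i) C 𝒟 z) →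
      IsBlowup τ C →
        K ≤ C.map i ^ 1 ∧
        ∃ (X' : Scheme.{u}) (σ : X' ⟶ X) (i' : E' ⟶ X'),
          IsBlowup σ (C.map i) ∧ i' ≫ σ = τ ≫ i ∧
          DepthInvariantMono 2 S I E' X' i' (σ ≫ g) (controlledTransform σ (C.map i) K 1)
            (N.comap σ * (C.map i).comap σ ^ (2 - 1)) ∧
          (controlledTransform σ (C.map i) K 1).comap i' = controlledTransform τ C (K.comap i) 1 ∧
          Q i' (controlledTransform σ (C.map i) K 1) (N.comap σ * (C.map i).comap σ ^ (2 - 1))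
            (𝒟.map (fun p => (strictTransformIdeal τ C p.1, p.2)) ++
              [(C.comap τ, weightOf 𝒟 (divisorsOver 𝒟 C C.support) + 1)])

/-- [OURS · L1 W5.2] **`TowerSep Q` — the WEIGHT-ONE TOWER of stage 2**: every `IsSepSeq` on the E-side starting from
`(K|_E, 𝒟)` is matched by a weighted sequence `π : X' ⟶ X` (weights `≤ 2`) with the invariant, `K'|_{E'} = 𝔟'` and `Q` at the
end.  PROVED from `StepSepOne` (`towerSep_of_stepSepOne`, §7). [cite: Kollar2007, 3.30.2] -/
def TowerSep
    (Q : ∀ ⦃E X : Scheme.{u}⦄, (E ⟶ X) → X.IdealSheafData → X.IdealSheafData → List (E.IdealSheafData × ℕ) → Prop) :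
    Prop :=
  ∀ (S : Type u) [CommRing S] [IsRegularLocalRing S] (I : Ideal S)
    (E X : Scheme.{u}) (i : E ⟶ X) (g : X ⟶ Spec (.of S)) (K N : X.IdealSheafData) (𝒟 : List (E.IdealSheafData × ℕ)),
    DepthInvariantMono 2 S I E X i g K N → Q i K N 𝒟 →
    ∀ (E' : Scheme.{u}) (ρ : E' ⟶ E) (𝔟' : E'.IdealSheafData) (𝒟' : List (E'.IdealSheafData × ℕ)),
      IsSepSeq ρ (K.comap i) 𝒟 𝔟' 𝒟' →
        ∃ (X' : Scheme.{u}) (π : X' ⟶ X) (i' : E' ⟶ X') (K' N' : X'.IdealSheafData),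
          IsWeightedSeq 2 π K K' ∧ i' ≫ π = ρ ≫ i ∧
          DepthInvariantMono 2 S I E' X' i' (π ≫ g) K' N' ∧ K'.comap i' = 𝔟' ∧ Q i' K' N' 𝒟'

/-- [OURS · L1 W5.2] **The END schema of stage 2, `EndTwoMonomialSep Q`**: at a terminal state (invariant, format `Q`, E-side
`EndSep (K|_E) 𝒟`) the X-side ideal is, up to a locally principal factor, a SUM OF TWO MONOMIALS in one family which is simple
normal crossings at every point of its cosupport — LITERALLY the conclusion of `EndTwoMonomialJR`, so that T5-M
`PointwisePairGame` (PROVED, p515425) finishes.  Intended: `M₀ = ⊤`, `A = (𝓗,1) :: (𝓘_E,0) :: (G,0)_G`,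
`B = (𝓗,0) :: (𝓘_E,2) :: (G,a_G)_G` over the N-charged members `G` (exponent-zero members left out of the family as in
`endFamily`, p515561); pointwise snc at `x ∈ i(E) ∩ cosupp K` from `EndSep` (coincidence case: replace `w_B` by `F`; else
replace the lifted local equation of `𝔟` by `F` — `∂F` has a unit coefficient there since `ord_x 𝔟 = 1`), at pockets from the
pocket field of `Q`. [cite: Kollar2007, (3.111) Step 3] [cite: BierstoneGrigorievMilmanWlodarczyk2011, §4 Step 2b] -/
def EndTwoMonomialSep
    (Q : ∀ ⦃E X : Scheme.{u}⦄, (E ⟶ X) → X.IdealSheafData → X.IdealSheafData → List (E.IdealSheafData × ℕ) → Prop) :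
    Prop :=
  ∀ (S : Type u) [CommRing S] [IsRegularLocalRing S] (I : Ideal S)
    (E X : Scheme.{u}) (i : E ⟶ X) (g : X ⟶ Spec (.of S)) (K N : X.IdealSheafData) (𝒟 : List (E.IdealSheafData × ℕ)),
    DepthInvariantMono 2 S I E X i g K N → Q i K N 𝒟 → EndSep (K.comap i) 𝒟 →
      ∃ (M₀ : X.IdealSheafData) (A B : List (X.IdealSheafData × ℕ)),
        IsLocallyPrincipal M₀ ∧ boundaryOf A = boundaryOf B ∧
        (∀ x : X, x ∈ (monomialIdeal A ⊔ monomialIdeal B).support → DepthSNC.SNCWithAt (boundaryOf A) ⊤ x) ∧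
        K = M₀ * (monomialIdeal A ⊔ monomialIdeal B)

/-! ## §6 The ENGINES (definitions; PROVED compositions in §7) -/

/-- [OURS · L1 W5.2] **The STAGE-2 ENGINE `SepEngine Q`**: at ANY state of the depth-two monomial-contact invariant in format
`Q` whose E-side datum `(K|_E, 𝒟)` admits an `IsSepSeq` reaching `EndSep`, the conclusion of the CORE holds for every
`T = Bl_I Spec S`.  PROVED (§7, `sepEngine_of_targets`) from `TowerSep Q`, `EndTwoMonomialSep Q` and `PointwisePairGame`;
composed with stage 1 in `FlagEngineTwo Q₁`.
[cite: Kollar2007, (3.111) Step 3, 3.30.2] -/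
def SepEngine
    (Q : ∀ ⦃E X : Scheme.{u}⦄, (E ⟶ X) → X.IdealSheafData → X.IdealSheafData → List (E.IdealSheafData × ℕ) → Prop) :
    Prop :=
  ∀ (S : Type u) [CommRing S] [IsRegularLocalRing S] (I : Ideal S), I ≠ ⊥ →
  ∀ (E X : Scheme.{u}) (i : E ⟶ X) (g : X ⟶ Spec (.of S)) (K N : X.IdealSheafData) (𝒟 : List (E.IdealSheafData × ℕ)),
    DepthInvariantMono 2 S I E X i g K N → Q i K N 𝒟 →
    (∃ (E' : Scheme.{u}) (ρ : E' ⟶ E) (𝔟' : E'.IdealSheafData) (𝒟' : List (E'.IdealSheafData × ℕ)),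
        IsSepSeq ρ (K.comap i) 𝒟 𝔟' 𝒟' ∧ EndSep 𝔟' 𝒟') →
    ∀ (T : Scheme.{u}) (f : T ⟶ Spec (.of S)), IsBlowup f (affineBlowup.idealSheaf I) →
      ∃ (J : T.IdealSheafData) (T' : Scheme.{u}) (π : T' ⟶ T), J ≠ ⊥ ∧
        (∀ t : T, t ∈ J.support → f.base t = IsLocalRing.closedPoint S) ∧
        IsBlowup π J ∧ Scheme.IsRegular T'

/-- [OURS · L1 W5.2] **The F6 ENGINE `FlagEngineTwo Q₁`** (non-graded one-form depth two; the stage-2 format `Q` is internal —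
it enters only the composition): at ANY stage-1 state (literal contact
`DepthInvariant 2`, stage-1 format `Q₁ i K R₁`) whose E-side flag `(K|_E, R₁)` admits an `IsFlagSeq` reaching `EndFlag` followed by
an `IsSepSeq` (from the empty boundary) reaching `EndSep`, the conclusion of the CORE holds for every `T = Bl_I Spec S`.
PROVED (§7, `flagEngineTwo_of_targets`) from `TowerFlagTwo Q₁`, `InitialSep Q₁ Q`, `TowerSep Q`, `EndTwoMonomialSep Q`,
`PointwisePairGame`; with the E-side supplied by `StageOneFlag₃` + `SeparationBoundary₃` in `flagEngineTwo_threefold`.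
[cite: Kollar2007, (3.111) Step 3, 3.30.2] [cite: KawanoueMatsuki2016, §2] -/
def FlagEngineTwo
    (Q₁ : ∀ ⦃E X : Scheme.{u}⦄, (E ⟶ X) → X.IdealSheafData → E.IdealSheafData → Prop) : Prop :=
  ∀ (S : Type u) [CommRing S] [IsRegularLocalRing S] (I : Ideal S), I ≠ ⊥ →
  ∀ (E X : Scheme.{u}) (i : E ⟶ X) (g : X ⟶ Spec (.of S)) (K : X.IdealSheafData) (R₁ : E.IdealSheafData),
    DepthInvariant 2 S I E X i g K → Q₁ i K R₁ →
    (∃ (E' : Scheme.{u}) (ρ : E' ⟶ E) (𝔟' R₁' : E'.IdealSheafData),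
        IsFlagSeq ρ (K.comap i) R₁ 𝔟' R₁' ∧ EndFlag 𝔟' R₁' ∧
        ∃ (E'' : Scheme.{u}) (ρ' : E'' ⟶ E') (𝔟'' : E''.IdealSheafData) (𝒟'' : List (E''.IdealSheafData × ℕ)),
          IsSepSeq ρ' 𝔟' ([] : List (E'.IdealSheafData × ℕ)) 𝔟'' 𝒟'' ∧ EndSep 𝔟'' 𝒟'') →
    ∀ (T : Scheme.{u}) (f : T ⟶ Spec (.of S)), IsBlowup f (affineBlowup.idealSheaf I) →
      ∃ (J : T.IdealSheafData) (T' : Scheme.{u}) (π : T' ⟶ T), J ≠ ⊥ ∧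
        (∀ t : T, t ∈ J.support → f.base t = IsLocalRing.closedPoint S) ∧
        IsBlowup π J ∧ Scheme.IsRegular T'


end Summit.ResolutionOfSingularities.ResolutionOfSingularities.Theorems.DepthTargets

end
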